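import Literature.MathematicalPhysics.QuantumFieldTheory.Balaban1983to89.B9Eq33CovDerivVector

/-!
# `Balaban1983to89.B9Eq3117LaplaceDerivCommutator` — T. Bałaban, *Propagators for lattice gauge theories in a background field*, Commun. Math. Phys. **99**
# (1985) 389–434 [Balaban1985BackgroundPropagators] (3.3) p. 391, (3.8) p. 392, (3.23) p. 394 (`Δ^η_U = D^{η*}_U D^η_U`), (3.117)–(3.120) p. 419 (the identities by
# which `Δ` is commuted past `D` with remainders «small because the function `J = D*η⁻²Im ∂U` is small, if `U` satisfies the condition (3.36)»), (3.36) p. 396: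
# **THE EXACT LATTICE COMMUTATOR OF THE COVARIANT LAPLACIAN WITH A COVARIANT DIFFERENCE** — for ANY transporters `R` (forward) and `S` (backward) with
# `S_bR_b = 1`, any scale `c`, any fibre-valued site function `f`, direction `ν` and site `x`:
# `(D*D)(D_νf)(x) − D_ν((D*D)f)(x) = c³·Σ_μ { [R_{x,ν}R_{x+e_ν,μ} − R_{x,μ}R_{x+e_μ,ν}] f(x+e_μ+e_ν) + [R_{x,ν}S_{x+e_ν−e_μ,μ} − S_{x−e_μ,μ}R_{x−e_μ,ν}] f(x−e_μ+e_ν) }`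
# — two PLAQUETTE DEFECTS (each `O(‖U(∂p) − 1‖)`), whose SUM over the two plaquettes adjacent to the bond `⟨x, x+e_ν⟩` in the `(μ,ν)`-plane is the
# backward covariant difference of the plaquette field, i.e. `η³·J_ν` up to `O(‖U(∂p)−1‖²)`: the lattice form of `[∇_μ∇_μ, ∇_ν]u = 2F_{μν}∇_μu + (∇_μF_{μν})u`.
# This is the identity by which the covariant HESSIAN row of a solution of `Δ^η_U u = ω` (STOREY H's `H3`, `u = G′_kR_kG′_kD*_Uf`) reduces to GRADIENT rows:
# `(Δ^η_U + 1)(∇_νu) = ∇_νω + [Δ^η_U, ∇_ν]u + ∇_νu`, the commutator being `O(α)(‖∇_Uu‖ + ‖u‖)` in sup norm under the block's plaquette window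
# `‖U(∂p) − 1‖ ≤ αη²` AND current window `‖J‖ ≤ α` ((3.36)) — and NOT without the latter.  NE9 crux-team LEAF PROVER 01, gen 95.

statement-level skeleton of published theorems with citation tags; proofs where landed; nothing here is a claim about the Yang–Mills mass gap

CITATION HEADER (lean-in-tree rule).  Audit cell `pub-balaban`, sub-cell `t4`, BINDER row NE9; filed by NE9 crux-team LEAF PROVER 01
(`b2b-balaban-t4-ne9-formalise-leaf-01`, gen 95; bears_on: R4/N22).  Source READ first-hand (`paper:balaban1985-cmp99-background-propagators`, pp. 391–396, 419).
The CONTENT is [folklore] finite algebra in the vocabulary of the owner's `B9Eq33CovDerivVector` (`covDeriv c R`, `covDiv c S` with arbitrary linear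
transporters on `TSite d Pd`); print's (3.117)–(3.120) are the analogous identities for the vector operator — nothing of them is asserted here.

WHAT IS PROVED (sorry-free; proof lane — 0 `def`).
* `laplace_apply` — `(D*D f)(y) = c²Σ_μ (2f(y) − S_{y−e_μ,μ}f(y−e_μ) − R_{y,μ}f(y+e_μ))` under `S_bR_b = 1`.
* **`laplace_covDeriv_sub_covDeriv_laplace`** — the displayed exact commutator identity (pointwise, every `ν`, `x`).
HONEST SCOPE.  Exact algebra; the BOUND (plaquette window + `‖J‖ ≤ α` ⇒ `‖[Δ^η_U,∇_ν]u(x)‖ ≤ C(α‖∇_Uu‖_∞ + (α + α²η)‖u‖_∞)` near `x`) and the identification of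
the summed defects with the tree's `B9Eq39Adjoint.J` are the successor's file; no estimate of print; NOT summit progress (cell pub-balaban: NE9 NOT PRINTED ∕ NOT
PROVED; «NE9 ⇐ the named binders»; row WALLED ON A MODEL (O-NE9-1; #5 UNRULED); spine PROVED 0∕9; rung (B)+1 finite T⁴ — NOT infinite volume, NOT mass gap, NOT
BetaPertH, NOT Clay).  NEW file importing `B9Eq33CovDerivVector`; nothing modified.  Net new unproved facts: 0.
-/

noncomputable section

open scoped BigOperators

namespace Literature.MathematicalPhysics.QuantumFieldTheory.Balaban1983to89.B9Eq3117LaplaceDerivCommutator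

open B9SectCLatticeCarrier (Bond bpos btgt shift unshift shift_unshift unshift_shift)
open B4Sect5Torus (TSite)
open B9Eq33CovDerivVector (covDeriv covDiv covDeriv_apply_dir covDiv_apply)

variable {d : ℕ} {Pd : Fin d → ℕ} {𝕜 : Type*} [CommRing 𝕜] {V : Type*} [AddCommGroup V] [Module 𝕜 V]

/-- **The covariant Laplacian unfolded**: for mutually inverse transporters (`S_bR_b = 1`),
`(D*(Df))(y) = c²·Σ_μ (2f(y) − S_{y−e_μ,μ}f(y−e_μ) − R_{y,μ}f(y+e_μ))` (as `c • c • Σ_μ …`). [folklore]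
[cite: Balaban1985BackgroundPropagators, (3.3) p.391, (3.8) p.392, (3.23) p.394] -/
theorem laplace_apply (c : 𝕜) (R S : Bond d Pd → V →ₗ[𝕜] V) (hSR : ∀ b w, S b (R b w) = w) (f : TSite d Pd → V) (y : TSite d Pd) :
    covDiv c S (covDeriv c R f) y = c • (c • ∑ μ, ((2 : 𝕜) • f y - S (unshift μ y, μ) (f (unshift μ y)) - R (y, μ) (f (shift μ y)))) := by
  rw [covDiv_apply]
  congr 1
  rw [Finset.smul_sum]
  refine Finset.sum_congr rfl fun μ _ => ?_
  rw [covDeriv_apply_dir, covDeriv_apply_dir, shift_unshift, map_smul, map_sub, hSR]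
  rw [two_smul]
  simp only [smul_sub, smul_add]
  abel

/-- **THE EXACT LATTICE COMMUTATOR `[D*D, D_ν]`**: for `S_bR_b = 1`, every `f`, `ν`, `x`:
`(D*D)(y ↦ (Df)(y,ν))(x) − (D(D*Df))(x,ν) = c³·Σ_μ { [R_{x,ν}R_{x+e_ν,μ} − R_{x,μ}R_{x+e_μ,ν}] f(x+e_μ+e_ν) + [R_{x,ν}S_{x+e_ν−e_μ,μ} − S_{x−e_μ,μ}R_{x−e_μ,ν}] f(x+e_ν−e_μ) }`
(the two points `x+e_μ+e_ν`, `x+e_ν−e_μ` are written as they arise on each side: `shift μ (shift ν x)`∕`shift ν (shift μ x)` and `unshift μ (shift ν x)`∕`shift ν (unshift μ x)`).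
Each bracket is a plaquette defect; all other terms cancel exactly. [folklore]
[cite: Balaban1985BackgroundPropagators, (3.23) p.394, (3.117)–(3.120) p.419, (3.36) p.396] -/
theorem laplace_covDeriv_sub_covDeriv_laplace (c : 𝕜) (R S : Bond d Pd → V →ₗ[𝕜] V) (hSR : ∀ b w, S b (R b w) = w)
    (f : TSite d Pd → V) (ν : Fin d) (x : TSite d Pd) :
    covDiv c S (covDeriv c R (fun y => covDeriv c R f (y, ν))) x - covDeriv c R (covDiv c S (covDeriv c R f)) (x, ν) =
      c • (c • (c • ∑ μ,
        ((R (x, ν) (R (shift ν x, μ) (f (shift μ (shift ν x)))) - R (x, μ) (R (shift μ x, ν) (f (shift ν (shift μ x))))) +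
         (R (x, ν) (S (unshift μ (shift ν x), μ) (f (unshift μ (shift ν x)))) - S (unshift μ x, μ) (R (unshift μ x, ν) (f (shift ν (unshift μ x)))))))) := by
  simp only [laplace_apply c R S hSR, covDeriv_apply_dir, map_smul, map_sub, map_sum, smul_sub, smul_add,
    Finset.smul_sum, ← Finset.sum_sub_distrib]
  refine Finset.sum_congr rfl fun μ _ => ?_
  simp only [two_smul, smul_add]
  abel

end Literature.MathematicalPhysics.QuantumFieldTheory.Balaban1983to89.B9Eq3117LaplaceDerivCommutator

end
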